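import Literature.AlgebraicGeometry.Resolution.NodalFamilyRingSingularLocus
import Literature.AlgebraicGeometry.Resolution.BlowupsFlatBaseChange
import Literature.AlgebraicGeometry.Resolution.RegularHomRegularLocus
import Literature.AlgebraicGeometry.Resolution.QuasiExcellentField
import Literature.AlgebraicGeometry.Resolution.CompletedPullbackRegular
import Literature.AlgebraicGeometry.Resolution.CanonicalResolutionSmoothCentre
import Literature.AlgebraicGeometry.Resolution.AdicQuotient
import Literature.AlgebraicGeometry.Resolution.AdicCompletionRegular
import Mathlib.RingTheory.Flat.FaithfullyFlat.Algebra
import HarnessLib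

/-!
# De Jong's alteration theorem: [S1] of 4.27 (`DeJong1996NormalFormPairCentreFormalIdeal`) from the G-ring leaf

Topic: `Literature/AlgebraicGeometry/Resolution`. The named fact
`DeJong1996NormalFormPairCentreFormalIdeal` (`AlterationsNormalFormBlowupFormal.lean`; de Jong 1996,
4.27, p. 75: "Since `E` is smooth, its ideal in the rings of (ii) is given by `(u, v, t₁, t₂)`
after renumbering", with the dictionary of 3.5 between the components of `Sing(X)` through a
closed point `x` and the primes `𝔭_{ab} = (u, v, t_a, t_b)` of the formal model
`A = k⟦u, v, t₁, …, t_{d-1}⟧/(uv - t₁ ⋯ t_s) ≅ 𝒪̂_{X,x}`) is PROVED here from ONE standard leaf,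
`Matsumura1987_32_polynomial` (`ExcellentRings.lean`: polynomial rings over a field are G-rings,
Matsumura, Cor. of Thm. 32.6), and the algebra of the formal model
(`NodalFamilyRingSingularLocus.lean`: `Sing(A) = ⋃_{a<b≤s} V(𝔭_{ab})`, the `𝔭_{ab}` prime and
pairwise incomparable). The argument, for a closed point `x ∈ Ē ⊆ Sing(X)` of a pair in
Situation 4.25 and the isomorphism `e : 𝒪̂_{X,x} ≅ A` of 4.25 (ii):

1. For a component `E'` of `Sing(X)` through `x`, the completed ideal `Î_{E'} = I(E')_x 𝒪̂_{X,x}`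
   is PRIME (`isPrime_map_stalkIdeal_adicCompletion`): `𝒪̂/Î_{E'} ≅ (𝒪_{X,x}/I(E')_x)^`
   (Matsumura 8.11, `quotientCompletionEquiv`) is the completion of the regular local ring
   `𝒪_{E',x}` ("`E` is smooth"; 4.25: the components of `Sing(X)` are nonsingular;
   `isRegularLocalRing_stalk_quotient_stalkIdeal`), hence regular (Stacks 07NY), hence a domain.
2. `V(Î_{Sing X}) ⊆ Sing(Spec 𝒪̂_{X,x})`: a prime `𝔓 ⊇ Î_{Sing X}` contracts to a prime `𝔮` of
   `𝒪_{X,x}` whose point `x_𝔮 ∈ Sing(X)` (`fromSpecStalk_mem_iff_stalkIdeal_vanishingIdeal_le`),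
   so `(𝒪_{X,x})_𝔮 = 𝒪_{X,x_𝔮}` is not regular (`isRegularLocalRing_localization_stalk_iff`), and
   neither is `𝒪̂_𝔓` (descent). Hence (1 + `Sing(A) ⊆ ⋃ V(𝔭_{ab})`): `e(Î_{E'}) ⊇ 𝔭_{ab}` for
   some `a < b ≤ s` (step α).
3. Conversely every `𝔭_{ab}` arises (step β): `𝔓 = e⁻¹𝔭_{ab}` is a non-regular prime of
   `𝒪̂_{X,x}` (`V(𝔭_{ab}) ⊆ Sing(A)`), so — `𝒪_{X,x}` being a G-RING (the leaf, through
   `Scheme.isQuasiExcellent_of_locallyOfFiniteType_of_polynomial` and `isGRing_of_isLocalization`),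
   whence `Reg(Spec 𝒪̂) = (Reg(Spec 𝒪))⁻¹` (EGA IV₂ 7.8.3 (v),
   `IsGRing.isRegularLocalRing_localization_adicCompletion_iff`) — its contraction `𝔮` gives a
   point `x_𝔮 ∈ Sing(X)` generising `x`, lying on a component `E'' ∋ x` with `Î_{E''} ⊆ 𝔓`; by
   step α, `𝔭_{a'b'} ⊆ e(Î_{E''}) ⊆ 𝔭_{ab}`, so `(a', b') = (a, b)` and `e(Î_{E''}) = 𝔭_{ab}`.
4. Step γ: for `E' ∋ x`, steps α and β give `E'' ∋ x` with `e(Î_{E''}) = 𝔭_{ab} ⊆ e(Î_{E'})`;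
   faithful flatness of the completion (`comap_map_stalk_adicCompletion`) gives
   `I(E'')_x ⊆ I(E')_x`, so `E' ⊆ E''` (test at the generic point of `E'`,
   `eq_of_stalkIdeal_vanishingIdeal_le`), so `E' = E''` and `e(Î_{E'}) = 𝔭_{ab}`.

* `DeJong1996NormalFormPairCentreFormalIdeal.of_polynomial :
  Matsumura1987_32_polynomial → DeJong1996NormalFormPairCentreFormalIdeal` (through
  `…of_polynomial_aux`, which takes the algebra of the formal model as hypotheses).
* PROVED bookkeeping: `isGRing_stalk_of_polynomial`, `isRegularLocalRing_localization_congr`,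
  `isRegularLocalRing_localization_comap_ringEquiv_iff` / `…map_ringEquiv_iff` (transport of
  `R_𝔓` along a ring isomorphism).

## Sources

* A. J. de Jong, *Smoothness, semi-stability and alterations*, Publ. Math. IHÉS 83 (1996) 51–93:
  3.5 (p. 64), 4.25–4.27 (pp. 75–76). [DeJong1996]
* H. Matsumura, *Commutative Ring Theory* (1986): Thm. 8.11, Thm. 8.14 (faithful flatness of the
  completion), Thm. 14.3, Thm. 23.7, §32 (G-rings; Cor. of Thm. 32.6). [Matsumura1987]
* A. Grothendieck, EGA IV₂, Scholie 7.8.3 (v) — through `RegularHomRegularLocus.lean`.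
* The Stacks Project, Tags 07NY, 07PF.
-/

noncomputable section

open CategoryTheory CategoryTheory.Limits AlgebraicGeometry TopologicalSpace Topology

namespace Literature.AlgebraicGeometry.Resolution

universe u

open IsLocalRing Scheme.IdealSheafData

/-! ## Completed stalk ideals: primality for regular subschemes, faithful flatness -/

section Stalk

variable {X : Scheme.{u}} [IsLocallyNoetherian X] (x : X)

/-- **The completed ideal of a regular closed subscheme is prime**: if `V(C)` is a regular
scheme and `x ∈ V(C)`, then `C_x · 𝒪̂_{X,x}` is a prime ideal of the completion `𝒪̂_{X,x}` —
`𝒪̂_{X,x} / C_x 𝒪̂_{X,x} ≅ (𝒪_{X,x}/C_x)^` (Matsumura Thm. 8.11, `quotientCompletionEquiv`) is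
the completion of the regular local ring `𝒪_{V(C),x} = 𝒪_{X,x}/C_x`, hence regular
(Stacks 07NY, `isRegularLocalRing_adicCompletion`), hence a domain (Matsumura Thm. 14.3).
("Since `E` is smooth … ": a nonsingular subvariety is analytically irreducible.)
[cite: Matsumura1987, Thm. 8.11 and Thm. 14.3] -/
theorem isPrime_map_stalkIdeal_adicCompletion {C : X.IdealSheafData}
    (hC : Scheme.IsRegular C.subscheme) (hx : x ∈ C.support) :
    ((stalkIdeal C x).map (algebraMap (X.presheaf.stalk x)
      (AdicCompletion (maximalIdeal (X.presheaf.stalk x)) (X.presheaf.stalk x)))).IsPrime := by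
  set O := X.presheaf.stalk x
  set J : Ideal O := stalkIdeal C x with hJ
  have hJle : J ≤ maximalIdeal O := (mem_support_iff_stalkIdeal_le C x).mp hx
  have hJne : J ≠ ⊤ := fun h => (maximalIdeal.isMaximal O).ne_top (top_le_iff.mp (h ▸ hJle))
  haveI : Nontrivial (O ⧸ J) := Ideal.Quotient.nontrivial_iff.mpr hJne
  haveI : IsLocalRing (O ⧸ J) := IsLocalRing.of_surjective' _ Ideal.Quotient.mk_surjective
  haveI : IsRegularLocalRing (O ⧸ J) := isRegularLocalRing_stalk_quotient_stalkIdeal hC hx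
  -- `Ô / J Ô ≅ (O/J)^`, a regular local ring
  have hmax : (maximalIdeal O).map (Ideal.Quotient.mk J) = maximalIdeal (O ⧸ J) :=
    (maximalIdeal_quotient_eq_map J).symm
  have e₀ := quotientCompletionEquiv (maximalIdeal O) J
  rw [hmax] at e₀
  haveI : IsRegularLocalRing (AdicCompletion (maximalIdeal (O ⧸ J)) (O ⧸ J)) :=
    isRegularLocalRing_adicCompletion (O ⧸ J)
  haveI : IsDomain (AdicCompletion (maximalIdeal (O ⧸ J)) (O ⧸ J)) :=
    isDomain_of_isRegularLocalRing _
  haveI : IsDomain (AdicCompletion (maximalIdeal O) O ⧸ J.map (algebraMap O _)) :=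
    e₀.toMulEquiv.isDomain _
  exact (Ideal.Quotient.isDomain_iff_prime _).mp ‹_›

/-- **Faithful flatness of the completion**: `I 𝒪̂_{X,x} ∩ 𝒪_{X,x} = I`. [cite: Matsumura1987, Thm. 8.14] -/
theorem comap_map_stalk_adicCompletion (I : Ideal (X.presheaf.stalk x)) :
    (I.map (algebraMap (X.presheaf.stalk x)
      (AdicCompletion (maximalIdeal (X.presheaf.stalk x)) (X.presheaf.stalk x)))).comap
      (algebraMap (X.presheaf.stalk x)
        (AdicCompletion (maximalIdeal (X.presheaf.stalk x)) (X.presheaf.stalk x))) = I := by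
  haveI : Module.FaithfullyFlat (X.presheaf.stalk x)
      (AdicCompletion (maximalIdeal (X.presheaf.stalk x)) (X.presheaf.stalk x)) :=
    Module.FaithfullyFlat.of_flat_of_isLocalHom
  exact Ideal.comap_map_eq_self_of_faithfullyFlat I

omit [IsLocallyNoetherian X] in
/-- **The local ring at a generization of `x` is a localization of `𝒪_{X,x}`**, read on
regularity: for a prime `𝔮` of `𝒪_{X,x}` and the corresponding point `x_𝔮` of `X`
(`Spec 𝒪_{X,x} → X`, a flat preimmersion), `(𝒪_{X,x})_𝔮` is regular iff `𝒪_{X,x_𝔮}` is.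
[folklore] -/
theorem isRegularLocalRing_localization_stalk_iff (𝔮 : Spec (X.presheaf.stalk x)) :
    IsRegularLocalRing (Localization.AtPrime 𝔮.asIdeal) ↔
      IsRegularLocalRing (X.presheaf.stalk (X.fromSpecStalk x 𝔮)) := by
  haveI := flat_fromSpecStalk X x
  rw [← isRegularLocalRing_stalk_Spec_iff, ← Scheme.mem_regularLocus, ← Scheme.mem_regularLocus]
  exact mem_regularLocus_iff_of_flat_of_isPreimmersion (X.fromSpecStalk x) 𝔮

end Stalk

/-! ## Components through a point and generic points -/

section Components

variable {X : Scheme.{u}} {S : Set X}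

/-- A closed irreducible component `E'` of `S` through `x` is recovered from the stalk of its
ideal: if `I(E'')_x ⊆ I(E')_x` for another component `E''`, then `E' ⊆ E''` (test at the
generic point of `E'`, which generises `x`), hence `E' = E''`. [folklore] -/
theorem eq_of_stalkIdeal_vanishingIdeal_le (hS : IsClosed S) {x : X} {E' E'' : Set X}
    (hE' : E' ∈ componentsIn S) (hE'' : E'' ∈ componentsIn S) (hx : x ∈ E')
    (h : stalkIdeal (vanishingIdeal ⟨E'', componentsIn.isClosed hS hE''⟩) x ≤
      stalkIdeal (vanishingIdeal ⟨E', componentsIn.isClosed hS hE'⟩) x) : E' = E'' := by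
  have hirr := componentsIn.isIrreducible hE'
  have hE'c := componentsIn.isClosed hS hE'
  -- the generic point `η` of `E'` generises `x`, so it comes from `Spec 𝒪_{X,x}`
  let η := hirr.genericPoint
  have hη : IsGenericPoint η E' := by
    have := hirr.isGenericPoint_genericPoint_closure
    rwa [hE'c.closure_eq] at this
  have hηx : η ⤳ x := hη.specializes hx
  obtain ⟨𝔮, h𝔮⟩ : η ∈ Set.range (X.fromSpecStalk x) := by
    rw [Scheme.range_fromSpecStalk]
    exact hηx
  -- `η ∈ E''`
  have h1 : stalkIdeal (vanishingIdeal ⟨E', hE'c⟩) x ≤ 𝔮.asIdeal :=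
    (fromSpecStalk_mem_iff_stalkIdeal_vanishingIdeal_le x ⟨E', hE'c⟩ 𝔮).mp (h𝔮 ▸ hη.mem)
  have h2 : η ∈ E'' := by
    rw [← h𝔮]
    exact (fromSpecStalk_mem_iff_stalkIdeal_vanishingIdeal_le x ⟨E'', _⟩ 𝔮).mpr (h.trans h1)
  have hsub : E' ⊆ E'' := by
    rw [← hη.def]
    exact closure_minimal (Set.singleton_subset_iff.mpr h2) (componentsIn.isClosed hS hE'')
  exact Set.Subset.antisymm hsub ((mem_componentsIn_iff.mp hE').2.2 E''
    (componentsIn.subset hE'') (componentsIn.isIrreducible hE'') hsub)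

end Components

/-! ## [S1] from the G-ring leaf -/

/-- The local rings of a scheme locally of finite type over a field are G-rings, given that
polynomial rings over a field are (`Matsumura1987_32_polynomial`; quasi-excellence of the affine
charts, `Scheme.isQuasiExcellent_of_locallyOfFiniteType_of_polynomial`, localises,
`isGRing_of_isLocalization`). [cite: Matsumura1987, §32, Cor. of Thm. 32.6] -/
theorem isGRing_stalk_of_polynomial (hp : Matsumura1987_32_polynomial.{u}) {k : Type u} [Field k]
    {X : Scheme.{u}} (f : X ⟶ Spec (.of k)) [LocallyOfFiniteType f] (x : X) :
    IsGRing (X.presheaf.stalk x) := by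
  obtain ⟨U, hU, hxU, -⟩ :=
    exists_isAffineOpen_mem_and_subset (X := X) (x := x) (U := ⊤) (Opens.mem_top x)
  have hqe := Scheme.isQuasiExcellent_of_locallyOfFiniteType_of_polynomial hp f
  have hGU : IsGRing Γ(X, U) := (hqe ⟨U, hU⟩).isGRing
  letI := TopCat.Presheaf.algebra_section_stalk X.presheaf (⟨x, hxU⟩ : U)
  haveI hlocx := hU.isLocalization_stalk ⟨x, hxU⟩
  exact isGRing_of_isLocalization (hU.primeIdealOf ⟨x, hxU⟩).asIdeal.primeCompl hGU

/-- Regularity of the localisation at a prime only depends on the prime (not on the proof of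
primality, nor on the syntactic form of the ideal). [folklore] -/
theorem isRegularLocalRing_localization_congr {R : Type u} [CommRing R] {P P' : Ideal R}
    [hP : P.IsPrime] [hP' : P'.IsPrime] (h : P = P') :
    IsRegularLocalRing (Localization.AtPrime P) ↔ IsRegularLocalRing (Localization.AtPrime P') := by
  subst h
  exact Iff.rfl

/-- Transport of "the localisation at a prime is regular" along a ring isomorphism `e : R ≃ S`:
`R_{e⁻¹𝔔} ≅ S_𝔔`. [folklore] -/
theorem isRegularLocalRing_localization_comap_ringEquiv_iff {R S : Type u} [CommRing R]
    [CommRing S] (e : R ≃+* S) (Q : Ideal S) [Q.IsPrime] :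
    IsRegularLocalRing (Localization.AtPrime (Q.comap e)) ↔
      IsRegularLocalRing (Localization.AtPrime Q) := by
  let eloc : Localization.AtPrime (Q.comap e) ≃+* Localization.AtPrime Q :=
    IsLocalization.ringEquivOfRingEquiv (Localization.AtPrime (Q.comap e))
      (Localization.AtPrime Q) e (e.map_primeCompl_comap_eq Q)
  exact ⟨fun _ => IsRegularLocalRing.of_ringEquiv eloc,
    fun _ => IsRegularLocalRing.of_ringEquiv eloc.symm⟩

/-- The same with the prime given downstairs: `R_𝔓 ≅ S_{e(𝔓)}`. [folklore] -/
theorem isRegularLocalRing_localization_map_ringEquiv_iff {R S : Type u} [CommRing R]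
    [CommRing S] (e : R ≃+* S) (P : Ideal R) [P.IsPrime] :
    IsRegularLocalRing (Localization.AtPrime (P.map e)) ↔
      IsRegularLocalRing (Localization.AtPrime P) := by
  haveI : ((P.map e).comap e).IsPrime := Ideal.comap_isPrime e _
  rw [← isRegularLocalRing_localization_comap_ringEquiv_iff e (P.map e)]
  exact isRegularLocalRing_localization_congr (Ideal.comap_map_of_bijective e e.bijective)

open DeJong1996 in
/-- **[S1] (`DeJong1996NormalFormPairCentreFormalIdeal`) from the G-ring leaf and the algebra of
the formal model**, the latter taken as hypotheses (`hSing₁`: `Sing(A) ⊆ ⋃ V(𝔭_{ab})`; `hSing₂`: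
`V(𝔭_{ab}) ⊆ Sing(A)`; `hinj`: `𝔭_{ab}` determines the pair; `hprime`: `𝔭_{ab}` is prime — all
proved in `NodalFamilyRingSingularLocus.lean`). See
`DeJong1996NormalFormPairCentreFormalIdeal.of_polynomial` for the instantiated statement and the
proof sketch. [cite: DeJong1996, 4.27, p. 75; 3.5, p. 64] -/
theorem DeJong1996NormalFormPairCentreFormalIdeal.of_polynomial_aux
    (hp : Matsumura1987_32_polynomial.{u})
    (hSing₁ : ∀ (k : Type u) [Field k] (m s : ℕ), 2 ≤ s → s ≤ m →
      ∀ (𝔮 : Ideal (NodalFamilyRing k m s)) [𝔮.IsPrime],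
        ¬ IsRegularLocalRing (Localization.AtPrime 𝔮) →
          ∃ a b : Fin m, a < b ∧ b.val < s ∧ nodalCentreIdeal k m s a b ≤ 𝔮)
    (hSing₂ : ∀ (k : Type u) [Field k] (m s : ℕ), s ≤ m → ∀ {a b : Fin m}, a ≠ b →
      a.val < s → b.val < s → ∀ (𝔮 : Ideal (NodalFamilyRing k m s)) [𝔮.IsPrime],
        nodalCentreIdeal k m s a b ≤ 𝔮 → ¬ IsRegularLocalRing (Localization.AtPrime 𝔮))
    (hinj : ∀ (k : Type u) [Field k] (m s : ℕ) {a b a' b' : Fin m}, a < b → b.val < s →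
      a' < b' → b'.val < s →
        nodalCentreIdeal k m s a b ≤ nodalCentreIdeal k m s a' b' → a = a' ∧ b = b')
    (hprime : ∀ (k : Type u) [Field k] (m s : ℕ) {a b : Fin m}, a ≠ b → a.val < s →
      b.val < s → (nodalCentreIdeal k m s a b).IsPrime) :
    DeJong1996NormalFormPairCentreFormalIdeal.{u} := by
  intro k _ _ X f Z d h E hE x hxc hx
  -- the singular locus and the centre
  let S : Set X := {x : X | ¬ IsRegularLocalRing (X.presheaf.stalk x)}
  have hS : IsClosed S := h.isClosed_setOf_not_isRegularLocalRing
  haveI := h.isIntegral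
  haveI := h.locallyOfFiniteType
  haveI : IsNoetherian X := h.isNoetherian
  have hĒeq : closure (Subtype.val '' E) = Subtype.val '' E := closure_image_val_eq hS hE
  have hĒmem : closure (Subtype.val '' E) ∈ componentsIn S := by
    rw [hĒeq]
    exact componentsIn.image_val_mem hE
  have hxS : ¬ IsRegularLocalRing (X.presheaf.stalk x) := componentsIn.subset hĒmem hx
  -- 4.25 (ii) at `x`
  obtain ⟨s, r, hs2, hsr, hrd, e, hZ⟩ := h.exists_ringEquiv_of_not_isRegularLocalRing x hxc hxS
  refine ⟨s, r, hs2, hsr, hrd, e, hZ, ?_⟩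
  -- notation
  let O := X.presheaf.stalk x
  let Ô := AdicCompletion (maximalIdeal O) O
  let c : O →+* Ô := algebraMap O Ô
  let Î : Closeds X → Ideal Ô := fun T => (stalkIdeal (vanishingIdeal T) x).map c
  have hÎU : ∀ (T : Closeds X) (U : X.affineOpens) (hU : x ∈ (U : X.Opens)),
      (completedStalkIdeal (vanishingIdeal T) x U hU).map e.toRingHom = (Î T).map e := by
    intro T U hU
    rw [completedStalkIdeal_eq_map_stalkIdeal]
    rfl
  have hÎmono : ∀ {T T' : Closeds X}, T ≤ T' → Î T' ≤ Î T := fun hTT' =>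
    Ideal.map_mono (stalkIdeal_mono (vanishingIdeal_antimono hTT') x)
  -- `𝒪_{X,x}` is a G-ring
  have hGA : IsGRing O := isGRing_stalk_of_polynomial hp f x
  -- F4: `V(Î_S) ⊆ Sing(Ô)`
  have F4 : ∀ (𝔓 : Ideal Ô) [𝔓.IsPrime], Î ⟨S, hS⟩ ≤ 𝔓 →
      ¬ IsRegularLocalRing (Localization.AtPrime 𝔓) := by
    intro 𝔓 _ hle hreg
    obtain ⟨hiff, -⟩ := hGA.isRegularLocalRing_localization_adicCompletion_iff 𝔓
    have h1 : IsRegularLocalRing (Localization.AtPrime (𝔓.under O)) := hiff.mp hreg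
    let 𝔮 : Spec O := ⟨𝔓.under O, inferInstance⟩
    have h2 := (isRegularLocalRing_localization_stalk_iff x 𝔮).mp h1
    have h3 : X.fromSpecStalk x 𝔮 ∈ ((⟨S, hS⟩ : Closeds X) : Set X) := by
      refine (fromSpecStalk_mem_iff_stalkIdeal_vanishingIdeal_le x ⟨S, hS⟩ 𝔮).mpr ?_
      change _ ≤ Ideal.comap c 𝔓
      rw [← Ideal.map_le_iff_le_comap]
      exact hle
    exact h3 h2
  -- F5: `Ô ≅ A` on regularity of localisations
  have F5 : ∀ (𝔓 : Ideal Ô) [𝔓.IsPrime],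
      IsRegularLocalRing (Localization.AtPrime 𝔓) ↔
        IsRegularLocalRing (Localization.AtPrime (𝔓.map e)) := fun 𝔓 _ =>
    (isRegularLocalRing_localization_map_ringEquiv_iff e 𝔓).symm
  -- Step α: every component through `x` has a prime completed ideal containing some `𝔭_{ab}`
  have hm : s ≤ d - 1 := hsr.trans hrd
  have stepα : ∀ E' (hE' : E' ∈ componentsIn S), x ∈ E' →
      (Î ⟨E', componentsIn.isClosed hS hE'⟩).IsPrime ∧
        ∃ a b : Fin (d - 1), a < b ∧ b.val < s ∧
          nodalCentreIdeal k (d - 1) s a b ≤ (Î ⟨E', componentsIn.isClosed hS hE'⟩).map e := by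
    intro E' hE' hxE'
    have hE'c := componentsIn.isClosed hS hE'
    -- the reduced component is a regular scheme (4.25)
    obtain ⟨E'', hE'', hE''eq⟩ := id hE'
    have hE''eq : Subtype.val '' E'' = E' := hE''eq
    have hreg : Scheme.IsRegular (vanishingIdeal ⟨E', hE'c⟩).subscheme := by
      have hC : (⟨closure (Subtype.val '' E''), isClosed_closure⟩ : Closeds X) = ⟨E', hE'c⟩ :=
        Closeds.ext (by simp only [Closeds.coe_mk]; rw [hE''eq, hE'c.closure_eq])
      rw [← hC]
      exact h.isRegular_subscheme E'' hE''
    have hxsupp : x ∈ (vanishingIdeal ⟨E', hE'c⟩).support := by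
      rw [← SetLike.mem_coe, coe_support_vanishingIdeal]
      exact hxE'
    haveI hP : (Î ⟨E', hE'c⟩).IsPrime := isPrime_map_stalkIdeal_adicCompletion x hreg hxsupp
    refine ⟨hP, ?_⟩
    have hle : Î ⟨S, hS⟩ ≤ Î ⟨E', hE'c⟩ := hÎmono (componentsIn.subset ⟨E'', hE'', hE''eq⟩)
    have h1 := F4 (Î ⟨E', hE'c⟩) hle
    rw [F5] at h1
    exact hSing₁ k (d - 1) s hs2 hm _ h1
  -- Step β: every `𝔭_{ab}` is the completed ideal of some component through `x`
  have stepβ : ∀ a b : Fin (d - 1), a < b → b.val < s →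
      ∃ E'' : Set X, ∃ hE'' : E'' ∈ componentsIn S, x ∈ E'' ∧
        (Î ⟨E'', componentsIn.isClosed hS hE''⟩).map e = nodalCentreIdeal k (d - 1) s a b := by
    intro a b hab hbs
    have has : a.val < s := lt_trans hab hbs
    haveI := hprime k (d - 1) s hab.ne has hbs
    -- `𝔓 = e⁻¹ 𝔭_{ab}` is a non-regular prime of `Ô`
    let 𝔓 : Ideal Ô := (nodalCentreIdeal k (d - 1) s a b).comap e
    haveI : 𝔓.IsPrime := Ideal.comap_isPrime e _
    have h𝔓map : 𝔓.map e = nodalCentreIdeal k (d - 1) s a b :=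
      Ideal.map_comap_of_surjective e e.surjective _
    have h1 : ¬ IsRegularLocalRing (Localization.AtPrime 𝔓) := by
      rw [F5]
      exact hSing₂ k (d - 1) s hm hab.ne has hbs (𝔓.map e) h𝔓map.ge
    -- so its contraction `𝔮` to `𝒪_{X,x}` is a non-regular point of `X` (G-ring!)
    obtain ⟨hiff, -⟩ := hGA.isRegularLocalRing_localization_adicCompletion_iff 𝔓
    let 𝔮 : Spec O := ⟨𝔓.under O, inferInstance⟩
    have h2 : ¬ IsRegularLocalRing (X.presheaf.stalk (X.fromSpecStalk x 𝔮)) := fun hreg =>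
      h1 (hiff.mpr ((isRegularLocalRing_localization_stalk_iff x 𝔮).mpr hreg))
    -- a component `E''` of `S` through that point, hence through `x`
    obtain ⟨E'', hE'', hqE''⟩ := componentsIn.exists_mem (S := S) h2
    have hE''c := componentsIn.isClosed hS hE''
    have hspec : X.fromSpecStalk x 𝔮 ⤳ x := Scheme.range_fromSpecStalk.le ⟨𝔮, rfl⟩
    have hxE'' : x ∈ E'' := hspec.mem_closed hE''c hqE''
    refine ⟨E'', hE'', hxE'', ?_⟩
    -- `Î_{E''} ≤ 𝔓`
    have h3 : Î ⟨E'', hE''c⟩ ≤ 𝔓 := by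
      rw [Ideal.map_le_iff_le_comap]
      exact (fromSpecStalk_mem_iff_stalkIdeal_vanishingIdeal_le x ⟨E'', hE''c⟩ 𝔮).mp hqE''
    -- `𝔭_{a'b'} ≤ Î_{E''} ε ≤ 𝔓 ε = 𝔭_{ab}` forces `(a', b') = (a, b)`
    obtain ⟨-, a', b', hab', hb's, h4⟩ := stepα E'' hE'' hxE''
    have h5 : (Î ⟨E'', hE''c⟩).map e ≤ nodalCentreIdeal k (d - 1) s a b :=
      h𝔓map ▸ Ideal.map_mono h3
    obtain ⟨rfl, rfl⟩ := hinj k (d - 1) s hab' hb's hab hbs (h4.trans h5)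
    exact le_antisymm h5 h4
  -- Step γ: the completed ideal of a component through `x` IS some `𝔭_{ab}`
  have stepγ : ∀ E' (hE' : E' ∈ componentsIn S), x ∈ E' →
      ∃ a b : Fin (d - 1), a < b ∧ b.val < s ∧
        (Î ⟨E', componentsIn.isClosed hS hE'⟩).map e = nodalCentreIdeal k (d - 1) s a b := by
    intro E' hE' hxE'
    obtain ⟨-, a, b, hab, hbs, h1⟩ := stepα E' hE' hxE'
    obtain ⟨E'', hE'', hxE'', h2⟩ := stepβ a b hab hbs
    refine ⟨a, b, hab, hbs, ?_⟩
    -- `Î_{E''} ε = 𝔭 ≤ Î_{E'} ε`, so `I_{E''} ≤ I_{E'}`, so `E' = E''`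
    have h3 : Î ⟨E'', componentsIn.isClosed hS hE''⟩ ≤ Î ⟨E', componentsIn.isClosed hS hE'⟩ := by
      have := Ideal.comap_mono (f := e) (h2.le.trans h1)
      rwa [Ideal.comap_map_of_bijective e e.bijective,
        Ideal.comap_map_of_bijective e e.bijective] at this
    have h4 : stalkIdeal (vanishingIdeal ⟨E'', componentsIn.isClosed hS hE''⟩) x ≤
        stalkIdeal (vanishingIdeal ⟨E', componentsIn.isClosed hS hE'⟩) x := by
      have := Ideal.comap_mono (f := c) h3
      rwa [comap_map_stalk_adicCompletion, comap_map_stalk_adicCompletion] at this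
    obtain rfl := eq_of_stalkIdeal_vanishingIdeal_le hS hE' hE'' hxE' h4
    exact h2
  -- Step δ: assemble
  obtain ⟨a₀, b₀, hab₀, hb₀s, h₀⟩ := stepγ _ hĒmem hx
  refine ⟨a₀, b₀, hab₀, hb₀s, fun U hU => ?_, fun E' hE' hxE' => ?_, fun a b hab hbs => ?_⟩
  · rw [hÎU, ← h₀]
  · obtain ⟨a, b, hab, hbs, h1⟩ := stepγ E' hE' hxE'
    refine ⟨a, b, hab, hbs, fun U hU => ?_⟩
    have hC : (⟨closure E', isClosed_closure⟩ : Closeds X) = ⟨E', componentsIn.isClosed hS hE'⟩ :=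
      Closeds.ext (componentsIn.isClosed hS hE').closure_eq
    rw [hÎU, hC, h1]
  · obtain ⟨E'', hE'', hxE'', h1⟩ := stepβ a b hab hbs
    refine ⟨E'', hE'', hxE'', fun U hU => ?_⟩
    have hC : (⟨closure E'', isClosed_closure⟩ : Closeds X) =
        ⟨E'', componentsIn.isClosed hS hE''⟩ :=
      Closeds.ext (componentsIn.isClosed hS hE'').closure_eq
    rw [hÎU, hC, h1]

/-- **[S1] of de Jong 1996, 4.27 with the dictionary of 3.5
(`DeJong1996NormalFormPairCentreFormalIdeal`) from the single standard leaf
`Matsumura1987_32_polynomial`** (polynomial rings over a field are G-rings), through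
`…of_polynomial_aux` with the algebra of the formal model supplied by
`NodalFamilyRingSingularLocus.lean`. [cite: DeJong1996, 4.27, p. 75; 3.5, p. 64] -/
theorem DeJong1996NormalFormPairCentreFormalIdeal.of_polynomial
    (hp : Matsumura1987_32_polynomial.{u}) : DeJong1996NormalFormPairCentreFormalIdeal.{u} :=
  DeJong1996NormalFormPairCentreFormalIdeal.of_polynomial_aux hp
    (fun k _ m s hs hsm 𝔮 _ h𝔮 =>
      DeJong1996.exists_nodalCentreIdeal_le_of_not_isRegularLocalRing k m s hs hsm 𝔮 h𝔮)
    (fun k _ m s hsm _ _ hab ha hb 𝔮 _ hle =>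
      DeJong1996.not_isRegularLocalRing_of_nodalCentreIdeal_le k m s hsm hab ha hb 𝔮 hle)
    (fun k _ m s _ _ _ _ hab hb hab' hb' hle =>
      DeJong1996.eq_of_nodalCentreIdeal_le k m s hab hb hab' hb' hle)
    (fun k _ m s _ _ hab ha hb => DeJong1996.isPrime_nodalCentreIdeal k m s hab ha hb)

/-- Hence [S3] at the closed points over the centre
(`DeJong1996NormalFormPairBlowupSingularOverCentre`) from `Matsumura1987_32_polynomial` and the
formal chart computation (`DeJong1996NodalBlowupSingularLocus`) alone.
[cite: DeJong1996, 4.27, pp. 75–76] -/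
theorem DeJong1996NormalFormPairBlowupSingularOverCentre.of_polynomial_of_nodalBlowup
    (hp : Matsumura1987_32_polynomial.{u}) (H₂ : DeJong1996NodalBlowupSingularLocus.{u}) :
    DeJong1996NormalFormPairBlowupSingularOverCentre.{u} :=
  DeJong1996NormalFormPairBlowupSingularOverCentre.of_centreFormalIdeal_of_nodalBlowup
    (DeJong1996NormalFormPairCentreFormalIdeal.of_polynomial hp) H₂

/-- And [C1] (`DeJong1996NormalFormPairBlowupSingularLocus`) from `Matsumura1987_32_polynomial`,
the formal chart computation and [S2]. [cite: DeJong1996, 4.27, pp. 75–76] -/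
theorem DeJong1996NormalFormPairBlowupSingularLocus.of_polynomial_of_nodalBlowup_of_strictTransformRegular
    (hp : Matsumura1987_32_polynomial.{u}) (H₂ : DeJong1996NodalBlowupSingularLocus.{u})
    (H₃ : DeJong1996NormalFormPairStrictTransformRegular.{u}) :
    DeJong1996NormalFormPairBlowupSingularLocus.{u} :=
  DeJong1996NormalFormPairBlowupSingularLocus.of_singularOverCentre_of_strictTransformRegular
    (DeJong1996NormalFormPairBlowupSingularOverCentre.of_polynomial_of_nodalBlowup hp H₂) H₃

end Literature.AlgebraicGeometry.Resolution

end
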